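import Mathlib
import HarnessLib
import HarnessLib.Audit
import Summits.HubbardSuperconductivity.Statement
import Literature.Probability.LatticeModels.TorusFourierProofs
import HarnessLib.Audit.Status.Attr

/-!
Route: AnomalyExhaustion

# Route AnomalyExhaustion — HubbardSuperconductivity (plancard, 2026-08-15; realises idea card
`irrational-doping-anomaly-exhaustion`, "Holmes at irrational doping")

## Thesis X (it suffices to show) — CONDITIONAL BRIDGE on the Else–Thorngren–Senthil classification
[ElseThorngrenSenthil2021]
Prove S by EXHAUSTION OF COMPETITORS at one irrational doping instead of by construction. Everything
is typed on the
summit's own objects: families of normalised (N_L, S^z=0)-sector ground states ψ_j of `hubbardTorus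
2 L_j 1 U` along a
strictly increasing sequence of EVEN sides L_j = M j + 1, N_L = 2⌊(1-δ)L²/2⌋ (no infinite-volume
states, no source field).
HYPOTHESIS H (`EtsTrichotomy`, the load-bearing conjecture, filed as an item so that it can be
REFUTED, never to be proved):
for every U > 0 and every IRRATIONAL δ ∈ (0,1/2), every such family shows, along the family,
 (A) pair condensation — Yang ODLRO frequently: ∃ c>0, ∃ᶠ j, c·L_j² ≤ λ_max(ρ₂(ψ_j))
(`Matrix.supRayleigh (twoParticleRDM ψ_j)`;
     ANY pair wavefunction: singlet/triplet, any centre-of-mass momentum), or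
 (B) a finite-range particle–hole DENSITY WAVE frequently: for some finite R ⊂ ℤ² and coefficients
a(e,σ,τ), the
     operator D_q = Σ_x χ_q(x) Σ_{e∈R,σ,τ} a(e,σ,τ) c†_{xσ}c_{x+e,τ} has ⟨D_q†D_q⟩ ≥ c·L_j⁴ at some
q ≠ 0 of the dual torus
     (charge/spin/bond/current waves of any period, incommensurate spirals, stripes, phase
separation via q ~ 2π/L), or
 (C) an ARC OF QUASIPARTICLE DISCONTINUITIES: ∃ σ, Z>0 and a non-degenerate continuous arc γ such
that at every point
     γ(t), for every ε>0, some ε-close momenta p, p' have n_j(σ,p') + Z ≤ n_j(σ,p) eventually in j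
     (n_j = torus momentum occupation L⁻²⟨c†(χ_k)c(χ_k)⟩ at the grid momentum k = ⌊pL/2π⌋; the
strong, Landau reading
     of ETS's "ersatz Fermi liquid" branch; an arc, not a point: a clean d-wave state has jump
POINTS at its 4 nodes).
H is ETS's Theorem 1 + §10 (arXiv:2007.07896 p. 9: at generic filling the IR symmetry of a symmetric
compressible state
cannot be a compact Lie group; pp. 30–31: otherwise U(1) or translations break, fourth option left
open) read on torus
sector ground states at irrational filling, where the Lieb–Schultz–Mattis–Oshikawa filling
constraint [Oshikawa2000,
HastingsPRB2004, NachtergaeleSimsCMP2007, BachmannEtAl2019] forbids every unique-gapped symmetric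
competitor at once.
X := H ∧ NoFermiArc ∧ NoDensityWave ∧ CondensateIsDWave, where the three UNCONDITIONAL weak-coupling
cruxes are
 rank 2 `NoFermiArc`: ∀ δ∈(0,1/2) ∃ U₀(δ)>0 ∀ U∈(0,U₀): no sector-GS family has an arc of
quasiparticle discontinuities
        (the Cooper-instability / Kohn–Luttinger NON-EXISTENCE theorem in ground-state form: branch
(C) is empty);
 rank 3 `NoDensityWave`: same quantifiers: max_{q≠0} ⟨D_q†D_q⟩ / L⁴ → 0 for EVERY finite-range p-h
density D
        (no particle–hole instability away from nesting at weak coupling: branch (B) is empty);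
 rank 4 `CondensateIsDWave`: ∀ δ∈(0,7/20) ∃ U₀(δ) ∀ U<U₀ ∃ c(U,δ)>0: eventually
c·λ_max(ρ₂(ψ_j))/L_j² ≤ L_j⁻⁴⟨Δ_d†Δ_d⟩_{ψ_j} + η
        for every η>0 (whatever condenses is captured by Scalapino's n.n. d_{x²-y²} pair field: B1g
Kohn–Luttinger leader
        [RaghuKivelsonScalapino2010] + Yang's bridge ⟨Δ_d†Δ_d⟩ = φ_d†ρ₂φ_d ≥ λ_max|⟨v,φ_d⟩|²).
Assembly X → S (soft analysis, provable now): take δ := √2/5 ∈ (0,7/20) irrational and U below the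
three thresholds; if
some sector-GS sequence lacked even-side d-wave LRO, `EvenSubsequenceReduction` (support) extracts
an even-side family with
L⁻⁴⟨Δ_d†Δ_d⟩ → 0; CondensateIsDWave kills (A) along it, NoDensityWave kills (B), NoFermiArc kills
(C) — contradicting H.
Lean (route file decls, all elaborated rc 0 against Mathlib + Literature on 2026-08-15):
`Assembly : EtsTrichotomy → NoFermiArc → NoDensityWave → CondensateIsDWave →
HubbardSuperconductivity`.

CONDITIONAL on ElseThorngrenSenthil2021 — this route is an explicit reduction to that named conjecture (D-0019: crux floor waived).

Rationale: ## Why this line (area imported: anomaly / filling-constraint classification of compressible phases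
+ weak-coupling many-body theory)
The card's syllogism: at IRRATIONAL doping no enlarged unit cell makes the filling integer, so
LSM–Oshikawa–Hastings–BBDF
filling constraints [Oshikawa2000, HastingsPRB2004, NachtergaeleSimsCMP2007, BachmannEtAl2019]
remove every unique-gapped
symmetric competitor along all tori at once, and the Else–Thorngren–Senthil classification
[ElseThorngrenSenthil2021, Thm 1
p. 9; §10 pp. 30-31 of arXiv:2007.07896] leaves three fates for a charge-conserving
translation-invariant system at generic
filling: U(1) breaking, translation breaking, or an (ersatz) Fermi surface. At weak repulsive U and
0<δ<1/2 the last two are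
believed impossible (no p-h instability away from nesting; Cooper/Kohn–Luttinger instability of any
inversion-symmetric Fermi
surface, RaghuKivelsonScalapino2010 p. 3), so a condensate remains, and the B1g Kohn–Luttinger
leader makes it d_{x²-y²}.
The novelty audits (-2, -15) asked to TYPE THE ERSATZ-FERMI-LIQUID BRANCH FIRST; this route does
exactly that, on torus sector
ground states (the summit's objects; Oshikawa's flux argument is a fixed-N torus argument), with
Yang's channel-free ODLRO for
(A), arbitrary finite-range particle–hole bilinears for (B), and an arc of quasiparticle jumps for
(C). Design consequence:
NO infinite-volume states and NO SSB⇒LRO transfer crux (WeakCouplingBCS stmt-0157 is not needed):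
the finite-volume reading is
folded into H, whose branch (A) is the weakest finite-volume shadow of U(1) breaking ('ODLRO
frequently').
Catalogue: physical analogy with an explicit dictionary (IR 'phases' ↦ three typed properties of GS
families); no spectral/
probabilistic/certified-computation component except the shared certified B1g item (stmt-0158)
behind crux 4.

## Ranked cruxes (2-4 unconditional; H is the named hypothesis, filed as support so refuters can
attack it)
2 NoFermiArc — hardest/most informative: a NON-EXISTENCE theorem about unknown ground states below
the BCS scale.
3 NoDensityWave — no particle–hole LRO at any q≠0, any finite-range channel, U<U₀(δ); the
a-priori-bound leg.
4 CondensateIsDWave — channel selection: c(U,δ)·λ_max/L² ≤ L⁻⁴⟨Δ_d†Δ_d⟩ + o(1); ties Yang ODLRO to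
Scalapino LRO (B1g, n.n. weight).
Supports: EtsTrichotomy [hypothesis], EvenSubsequenceReduction (liminf bookkeeping, provable now).
Assembly: pure soft analysis.

## Kill criteria
- EtsTrichotomy refuted anywhere in the Hubbard family (U>0, irrational δ<1/2) → route closes
`refuted` (it is the bridge).
- NoFermiArc or NoDensityWave refuted at weak coupling → close; CondensateIsDWave refuted → restate
the δ-window once
  (stmt-0158's certified interval decides), else close.
- Physics-level: a repulsive-U→0 mechanism for a symmetric compressible non-Fermi-liquid WITHOUT
pair condensation
  (pair 'Bose metal' à la MotrunichFisher2007 / arXiv:2405.13405, charge-4e, Z=0 ersatz FL) shown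
relevant at weak coupling
  on the square lattice → retire the line (H's strong reading would be the wrong conjecture).

## Deliberately NOT decomposed yet
Any proof strategy for cruxes 2-4 (pp-ladder/contrapositive RG for 2, susceptibility a-priori bounds
for 3, ρ₂-eigenvector
perturbation theory for 4); the Luttinger count in (C); the LSM/BBDF sector-form theorem (justifies
H, is not a premise —
requested as a Literature cite fact); uniformity of U₀ in δ; odd sides (the summit is even-side only
and so is every item).

## NOVELTY / BARRIERS — see the route's Novelty and Barriers fields (search log in NOTES.md of the
plancard unit).

Novelty: Nearest prior art (searched: the card's crossref searches + two refuter audits; this pass `lit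
galaxy search "ersatz Fermi liquid" --star all` (3 hits: Sachdev, Quantum Phases of Matter
[panama:439254895296555]; scipost Kondo-lattice numerics; arXiv:2210.14802 holographic zero sound —
none about superconductivity theorems), `lit galaxy search "Cooper pair Bose metal" --star pdf`
(arXiv:2405.13405 Cao et al. 2024, a 2D d-wave CPBM — feeds the hypothesis' why-might-fail), `lit
vsearch "incommensurate filling … superfluid, density wave or Luttinger Fermi surface"` and `lit
search --hybrid "Oshikawa commensurability flux insertion filling Luttinger theorem"` (textbook hits
only: Fabrizio 2022 p. 235, Essler et al. 2005 p. 347, Moessner–Moore 2021), `lit read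
arxiv:2007.07896` pp. 9, 30-31; OpenAlex/arXiv APIs 429 this hour). (1) ElseThorngrenSenthil2021
(doi:10.1103/physrevx.11.021005) Thm 1 p. 9 + §10: CLASSIFY compressible symmetric phases at generic
filling (compact IR symmetry impossible; superfluid and translation-broken branches; fourth option
open) — they derive Luttinger-type constraints, not order. (2) Oshikawa2000 / OshikawaLuttinger2000,
HastingsPRB2004, NachtergaeleSimsCMP2007, WatanabeEtAl2015, BachmannEtAl2019
(doi:10.1007/s00220-019-03537-x, example (ii) = LSM): 'non-integer filling ⇒ no unique gapped
symmetric GS' — the irrational-doping device is this corollary applied to all superlattices at once.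
(3) RaghuKivelsonScalapino2010 p. 3 (arXiv:1002.0591): the weak-c  [refs: 10.1103/physrevx.11.021005, 10.1007/s00220-019-03537-x, 2210.14802, 2405.13405, 2007.07896, 1002.0591, arxiv:2007.07896, doi:10.1103/physrevx.11.021005, doi:10.1007/s00220-019-03537-x, ElseThorngrenSenthil2021, Oshikawa2000, OshikawaLuttinger2000, HastingsPRB2004, NachtergaeleSimsCMP2007, WatanabeEtAl2015, BachmannEtAl2019, RaghuKivelsonScalapino2010, MotrunichFisher2007]

Barriers (technique_class: anomaly-exhaustion; filling-constraints; conditional-bridge): technique_class: anomaly-exhaustion; filling-constraints; conditional-bridge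
Catalogue Literature/Barriers/HubbardSuperconductivity/ (10 entries read 2026-08-15), one line each.
Literature.Barriers.HubbardSuperconductivity.LROForcesLowLyingStates: ALLIED, not evaded — the route
never asks for a non-zero anomalous average or a unique gapped GS; branch (A) of EtsTrichotomy is
Yang ODLRO of the SYMMETRIC sector ground state (evasion (i) of the entry: order as a two-point/ρ₂
statement), and LSM/filling constraints are exactly the statement that unique-gapped symmetric
competitors do not exist at fractional filling; no SSB⇒LRO transfer is used (everything is typed on
torus sector GS), so the entry's 'towers/low-lying states' content is consistent with every item.
Literature.Barriers.HubbardSuperconductivity.WeakCouplingCeiling: APPLIES in spirit to cruxes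
NoFermiArc / NoDensityWave / CondensateIsDWave (statements about TRUE ground states at small U, i.e.
below e^{-a/|U|}); NOT evaded and openly relocated: the bet (card + audits) is that NON-EXISTENCE
statements (no quasiparticle arc, no p-h LRO) and a RATIO statement (c·λ_max/L² ≤ L⁻⁴⟨Δ_d†Δ_d⟩ +
o(1)) can be reached by contrapositive/a-priori arguments that never construct the condensate nor
name its size — no convergent expansion down to T=0 is claimed by any item.
Literature.Barriers.HubbardSuperconductivity.PerturbativeInvisibilityOfPairing: DOES NOT APPLY as a
block — no item exhibits T_c, the gap or an order parameter of BCS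

Novelty grade: new-combination — ROUTE REVIEW 3rd pass (refuter b6478b34-0, 2026-08-15). VERDICT KEEP as CONDITIONAL BRIDGE; no block/refutation; grade unchanged. Independent checks: 6/6 decls rc0 with the REAL import; Assembly ≡ …→_root_.HubbardSuperconductivity ≡ Literature.Hubbard.DWaveSuperconductivityHubbard by Iff.rfl (W_unfo (refuter refuter-rreview-route-HubbardSuperconduc-b6478b34-0, 2026-08-15T14:03:33Z; prior: doi:10.1103/physrevx.11.021005 (ElseThorngrenSenthil2021 Thm 1, §10), doi:10.1007/s00220-019-03537-x (BachmannEtAl2019 LSM) / Oshikawa2000 / HastingsPRB2004 / NachtergaeleSimsCMP2007, arXiv:1002.0591 (RaghuKivelsonScalapino2010, B1g KL leader), doi:10.1103/physrevlett.64.1839 (Anderson1990, 2D Luttinger-liquid normal state Z=0: published COUNTER-conjecture to branch (C); absent from card/route), d)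

sub-problem: HubbardSuperconductivity · status: blocked · opened planner-plancard-HubbardSuperconductivity-Hub-227380fb-0 2026-08-15T10:56:35Z · rev 2 · ledger route-HubbardSuperconductivity-AnomalyExhaustion
GENERATED by the gate from the ledger (D-0016/17). Provers cite these decls: `theorem foo : Summit.HubbardSuperconductivity.HubbardSuperconductivity.Theses.AnomalyExhaustion.<Decl> := …` in Summits/HubbardSuperconductivity/HubbardSuperconductivity/Theorems/<Name>.lean.
-/

namespace Summit.HubbardSuperconductivity.HubbardSuperconductivity.Theses.AnomalyExhaustion

open scoped BigOperators Topology Manifold Classical MeasureTheory ProbabilityTheory Matrix InnerProductSpace ComplexConjugate ContinuousMap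
open Filter Set Function TopologicalSpace MeasureTheory

attribute [summit_statement] _root_.HubbardSuperconductivity

open Literature.Hubbard

/-- item stmt-HubbardSuperconductivity-1455 · crux · rank 2 · open · by planner
why it might fail: FALSE at U=0 (free Fermi sea: Z=1 on the whole Fermi curve), so it must switch on for every U>0 below the essential singularity e^{-1/(λU²)}, invisible to expansions (FKT need an asymmetric Fermi curve; BGM stop at T≳e^{-a/U}); false outright if a weak-U GS kept gapless Bogoliubov arcs (PDW).
sources: RaghuKivelsonScalapino2010, FeldmanKnorrerTrubowitz2004, BenfattoGiulianiMastropietro2006, Salmhofer1999, BergFradkinKivelson2009, doi:10.1103/physrevlett.118.127001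
[crux] NO ARC OF QUASIPARTICLE DISCONTINUITIES AT WEAK COUPLING (the Cooper-instability /
Kohn–Luttinger NON-EXISTENCE theorem in ground-state form; closes branch (C) of EtsTrichotomy). For
every δ∈(0,1/2) there is U₀(δ)>0 such that for 0<U<U₀ NO family of normalised (N_L,S^z=0)-sector
ground states ψ_j of hubbardTorus 2 L_j 1 U along strictly increasing EVEN sides L_j=M j+1
(N_L=2⌊(1-δ)L²/2⌋) has: some spin σ, Z>0 and a non-degenerate continuous arc γ:[0,1]→ℝ² such that at
every point γ(t), for every ε>0, some momenta p,p' within ε of γ(t) satisfy n_j(σ,p')+Z ≤ n_j(σ,p)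
eventually in j, where n_j(σ,p)=L_j⁻² Re Σ_{x,y} χ_k(x) conj(χ_k(y)) ⟨ψ_j, c†_{xσ}c_{yσ} ψ_j⟩ is the
occupation of the torus plane wave at grid momentum k=⌊p L_j/2π⌋ (mod L_j). Physics: an
inversion-symmetric Fermi surface with a quasiparticle jump on an arc is Cooper-unstable at any
repulsive U (attraction generated at O(U²)), so it cannot be a ground state; the expected d_{x²-y²}
state has n(k) continuous across the Fermi curve except at 4 nodal POINTS (hence 'arc'). Proof ideas
(not decomposed): contrapositive use of the pp-ladder / Fermi-liquid constructions (FKT 2004 need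
ASYMMETRY exactly to avoid this), tria -/
@[route_item "route-HubbardSuperconductivity-AnomalyExhaustion"]
def NoFermiArc : Prop :=
  open Literature.MathematicalPhysics.QuantumLattice Literature.Probability.LatticeModels in ∀ δ ∈ Set.Ioo (0 : ℝ) (1 / 2), ∃ U₀ : ℝ, 0 < U₀ ∧ ∀ (U : ℝ) (M : ℕ → ℕ) (ψ : ∀ j, Fock (Orb (FermionTorus 2 (M j + 1)))), U ∈ Set.Ioo (0 : ℝ) U₀ → (StrictMono M ∧ ∀ j, Even (M j + 1) ∧ star (ψ j) ⬝ᵥ ψ j = 1 ∧ IsGroundStateInSector (hubbardTorus 2 (M j + 1) 1 U) (2 * ⌊(1 - δ) * ((M j + 1 : ℕ) : ℝ) ^ 2 / 2⌋₊) 0 (ψ j)) → let nocc : (j : ℕ) → Fin 2 → (Fin 2 → ℝ) → ℝ := fun j σ p => (∑ x : TorusSite 2 (M j + 1), ∑ y : TorusSite 2 (M j + 1), torusChar (fun i => ((⌊p i * ((M j + 1 : ℕ) : ℝ) / (2 * Real.pi)⌋ : ℤ) : ZMod (M j + 1))) x * (starRingEnd ℂ) (torusChar (fun i => ((⌊p i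 * ((M j + 1 : ℕ) : ℝ) / (2 * Real.pi)⌋ : ℤ) : ZMod (M j + 1))) y) * expect (creation (orb (FermionTorus.ofTorusSite x) σ) * annihilation (orb (FermionTorus.ofTorusSite y) σ)) (ψ j)).re / ((M j + 1 : ℕ) : ℝ) ^ 2; ¬ ∃ (σ : Fin 2) (Z : ℝ) (γ : ℝ → (Fin 2 → ℝ)), 0 < Z ∧ Continuous γ ∧ γ 0 ≠ γ 1 ∧ ∀ t ∈ Set.Icc (0 : ℝ) 1, ∀ ε > (0 : ℝ), ∃ p p' : Fin 2 → ℝ, dist p (γ t) < ε ∧ dist p' (γ t) < ε ∧ ∀ᶠ j in atTop, nocc j σ p' + Z ≤ nocc j σ p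

/-- item stmt-HubbardSuperconductivity-1456 · crux · rank 3 · open · by planner
why it might fail: Bounds TRUE-GS structure factors at T=0 uniformly in q≠0 (incl. q~2π/L, phase separation) and every p-h channel: no a-priori bound or convergent expansion reaches T=0; U₀(δ)→0 as δ→0 (near-nesting χ₀: HF spirals/stripes/PS once U≳1/χ₀, Schulz1990, Igoshev2010; AF-led fRG flows, HalbothMetzner2000).
sources: Schulz1990, IgoshevEtAl2010, HalbothMetzner2000, RaghuKivelsonScalapino2010, ArovasBergKivelsonRaghu2022, Literature.Barriers.HubbardSuperconductivity.WeakCouplingCeiling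
[crux] NO PARTICLE–HOLE DENSITY WAVE AT WEAK COUPLING (closes branch (B) of EtsTrichotomy). For
every δ∈(0,1/2) there is U₀(δ)>0 such that for 0<U<U₀, for every even-side sector-GS family ψ_j as
in NoFermiArc, for EVERY finite R⊂ℤ² and coefficients a:ℤ²→Fin 2→Fin 2→ℂ (one-body density
d_x=Σ_{e∈R,σ,τ} a(e,σ,τ) c†_{xσ}c_{x+e,τ}: charge, spin S^z/S^±, bond kinetic, current/flux (DDW),
spin-current … of any finite range) and every c>0: eventually in j, for ALL q≠0 of the dual torus,
⟨ψ_j, D_q†D_q ψ_j⟩ ≤ c·L_j⁴ with D_q=Σ_x χ_q(x) d_x — i.e. max_{q≠0} S_d(q)/L⁴ → 0: no translation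
breaking in any particle–hole channel, at any commensurate or incommensurate wavevector, including
q~2π/L (phase separation). Physics: away from perfect nesting (δ>0, t'=0) all static p-h
susceptibilities of the band are finite (log-enhanced near (π,π±2πη) as δ→0, so U₀(δ)→0), and a p-h
instability needs U·χ ≳ 1, while the leading weak-coupling instability is pairing. Proof ideas (not
decomposed): a-priori bounds on S_d(q) uniform in the GS via correlation inequalities / linear
response sum rules; Hartree–Fock-level thresholds (Schulz1990, IgoshevEtAl2010) only as orientation.
Sources: RaghuKivelsonScalapino20 -/
@[route_item "route-HubbardSuperconductivity-AnomalyExhaustion"]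
def NoDensityWave : Prop :=
  open Literature.MathematicalPhysics.QuantumLattice Literature.Probability.LatticeModels in ∀ δ ∈ Set.Ioo (0 : ℝ) (1 / 2), ∃ U₀ : ℝ, 0 < U₀ ∧ ∀ (U : ℝ) (M : ℕ → ℕ) (ψ : ∀ j, Fock (Orb (FermionTorus 2 (M j + 1)))), U ∈ Set.Ioo (0 : ℝ) U₀ → (StrictMono M ∧ ∀ j, Even (M j + 1) ∧ star (ψ j) ⬝ᵥ ψ j = 1 ∧ IsGroundStateInSector (hubbardTorus 2 (M j + 1) 1 U) (2 * ⌊(1 - δ) * ((M j + 1 : ℕ) : ℝ) ^ 2 / 2⌋₊) 0 (ψ j)) → let dens : (j : ℕ) → Finset (Site 2) → (Site 2 → Fin 2 → Fin 2 → ℂ) → TorusSite 2 (M j + 1) → Matrix (Finset (Orb (FermionTorus 2 (M j + 1)))) (Finset (Orb (FermionTorus 2 (M j + 1)))) ℂ := fun j R a q => ∑ x : TorusSite 2 (M j + 1), torusChar q x • ∑ e ∈ R, ∑ σ : Fin 2, ∑ τ : Fin 2, a e σ τ • (creation (orb (FermionTorus.ofTorusSite x) σ) * annihilation (orb (FermionTorus.ofTorusSite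 (x + Torus.proj (M j + 1) e)) τ)); ∀ (R : Finset (Site 2)) (a : Site 2 → Fin 2 → Fin 2 → ℂ) (c : ℝ), 0 < c → ∀ᶠ j in atTop, ∀ q : TorusSite 2 (M j + 1), q ≠ 0 → (expect ((dens j R a q)ᴴ * dens j R a q) (ψ j)).re ≤ c * ((M j + 1 : ℕ) : ℝ) ^ 4

/-- item stmt-HubbardSuperconductivity-1457 · crux · rank 4 · open · by planner
why it might fail: Needs the top ρ₂-eigenvector of an unknown GS to be B1g WITH n.n. weight: c~Δ·log²(1/Δ) sits on the first B1g harmonic, not symmetry-protected; B1g lead is O(U²) only, uncertified (stmt-0158 open; RKS2010 plotting error per ABKR2022 p.13; d_xy for n≲0.6, Deng2015); O(U³) reshuffles channels.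
sources: RaghuKivelsonScalapino2010, DengEtAl2015, SimkovicEtAl2016, ArovasBergKivelsonRaghu2022, YangODLRO1962, Scalapino1995
[crux] WHATEVER CONDENSES IS CAPTURED BY SCALAPINO'S d_{x²-y²} PAIR FIELD (channel selection; turns
branch (A) = Yang ODLRO into the summit's order). For every δ∈(0,7/20) there is U₀(δ)>0 and, for
each 0<U<U₀, a constant c(U,δ)>0 such that for every even-side sector-GS family ψ_j and every η>0,
eventually in j: c·λ_max(ρ₂(ψ_j))/L_j² ≤ L_j⁻⁴ Re⟨ψ_j, Δ_d†Δ_d ψ_j⟩ + η (λ_max = Matrix.supRayleigh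
(twoParticleRDM ψ_j); Δ_d = pairField dWaveFormFactor L_j). Content: if ρ₂ has a macroscopic
eigenvalue (pair condensation in ANY channel/momentum) then the n.n. B1g pair field has LRO of
comparable size; trivially true where λ_max=o(L²). Mechanism: at weak coupling the condensate
wavefunction follows the most attractive O(U²) Kohn–Luttinger channel, B1g (x²-y²) at t'=0 for
0.6<n<1 (RaghuKivelsonScalapino2010 §III Fig. 2; certified ordering = shared item
stmt-HubbardSuperconductivity-0158 / WcbcsKohnLuttingerB1g), zero pair momentum, with non-zero
nearest-neighbour weight; then Yang's identity ⟨Δ_d†Δ_d⟩ = φ_d†ρ₂φ_d ≥ λ_max|⟨v,φ_d⟩|²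
(expect_pairAnnihilator_conjTranspose_mul, rayleigh_le_supRayleigh_holds; cf. YangSpectral crux 3
and hasPairFieldLRO_dWave_of_hasODLRO) gives the inequality with -/
@[route_item "route-HubbardSuperconductivity-AnomalyExhaustion"]
def CondensateIsDWave : Prop :=
  open Literature.MathematicalPhysics.QuantumLattice Literature.Probability.LatticeModels in ∀ δ ∈ Set.Ioo (0 : ℝ) (7 / 20), ∃ U₀ : ℝ, 0 < U₀ ∧ ∀ U ∈ Set.Ioo (0 : ℝ) U₀, ∃ c : ℝ, 0 < c ∧ ∀ (M : ℕ → ℕ) (ψ : ∀ j, Fock (Orb (FermionTorus 2 (M j + 1)))), (StrictMono M ∧ ∀ j, Even (M j + 1) ∧ star (ψ j) ⬝ᵥ ψ j = 1 ∧ IsGroundStateInSector (hubbardTorus 2 (M j + 1) 1 U) (2 * ⌊(1 - δ) * ((M j + 1 : ℕ) : ℝ) ^ 2 / 2⌋₊) 0 (ψ j)) → ∀ η > (0 : ℝ), ∀ᶠ j in atTop, c * (twoParticleRDM (ψ j)).supRayleigh / ((M j + 1 : ℕ) : ℝ) ^ 2 ≤ (expect ((pairField dWaveFormFactor (M j + 1))ᴴ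 * pairField dWaveFormFactor (M j + 1)) (ψ j)).re / ((M j + 1 : ℕ) : ℝ) ^ 4 + η

/-- item stmt-HubbardSuperconductivity-1458 · support · rank 9 · open · by planner
why it might fail: It is the conjecture, STRONG reading: ETS allow infinite emergent symmetry, so a Z=0 state evades (A),(B),(C) — Anderson1990's 2D-Hubbard Luttinger liquid (the published counter-conjecture to (C); FL rebuttal EngelbrechtRanderia1990), pair Bose metals (MotrunichFisher2007, 2405.13405), charge-4e.
sources: ElseThorngrenSenthil2021, Oshikawa2000, BachmannEtAl2019, HastingsPRB2004, NachtergaeleSimsCMP2007, MotrunichFisher2007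
[hypothesis] THE NAMED CONJECTURE OF THIS CONDITIONAL BRIDGE — NOT a proof target (do not staff
provers on it); filed as an item so that it is typed, visible and REFUTABLE (a Hubbard sector-GS
family violating all three branches closes the route). Hubbard–Else–Thorngren–Senthil trichotomy at
irrational doping, read on torus sector ground states: for every U>0 and every IRRATIONAL δ∈(0,1/2),
every family of normalised (N_L,S^z=0)-sector ground states ψ_j of hubbardTorus 2 L_j 1 U along
strictly increasing even sides L_j=M j+1, N_L=2⌊(1-δ)L²/2⌋, satisfies (A) PAIR CONDENSATION
frequently: ∃c>0, ∃ᶠ j, c·L_j² ≤ λ_max(ρ₂(ψ_j)) (Yang ODLRO, any pair wavefunction, any pair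
momentum) ∨ (B) a finite-range PARTICLE–HOLE DENSITY WAVE frequently: ∃ finite R⊂ℤ², a, c>0, ∃ᶠ j, ∃
q≠0 with ⟨D_q†D_q⟩ ≥ c·L_j⁴ (D_q as in NoDensityWave: charge/spin/bond/current waves of any period,
spirals, stripes, phase separation) ∨ (C) an ARC OF QUASIPARTICLE DISCONTINUITIES of the momentum
occupation n_j(σ,·) (as in NoFermiArc). Provenance: ElseThorngrenSenthil2021 Thm 1 (arXiv:2007.07896
p.9: at generic filling the emergent symmetry of a compressible state with unbroken
U(1)×translations cannot be a compact Lie -/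
@[route_item "route-HubbardSuperconductivity-AnomalyExhaustion", crux]
def EtsTrichotomy : Prop :=
  open Literature.MathematicalPhysics.QuantumLattice Literature.Probability.LatticeModels in ∀ (U δ : ℝ) (M : ℕ → ℕ) (ψ : ∀ j, Fock (Orb (FermionTorus 2 (M j + 1)))), 0 < U → δ ∈ Set.Ioo (0 : ℝ) (1 / 2) → Irrational δ → (StrictMono M ∧ ∀ j, Even (M j + 1) ∧ star (ψ j) ⬝ᵥ ψ j = 1 ∧ IsGroundStateInSector (hubbardTorus 2 (M j + 1) 1 U) (2 * ⌊(1 - δ) * ((M j + 1 : ℕ) : ℝ) ^ 2 / 2⌋₊) 0 (ψ j)) → let dens : (j : ℕ) → Finset (Site 2) → (Site 2 → Fin 2 → Fin 2 → ℂ) → TorusSite 2 (M j + 1) → Matrix (Finset (Orb (FermionTorus 2 (M j + 1)))) (Finset (Orb (FermionTorus 2 (M j + 1)))) ℂ := fun j R a q => ∑ x : TorusSite 2 (M j + 1), torusChar q x • ∑ e ∈ R, ∑ σ : Fin 2, ∑ τ : Fin 2, a e σ τ • (creation (orb (FermionTorus.ofTorusSite x) σ) * annihilation (orb (FermionTorus.ofTorusSite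 (x + Torus.proj (M j + 1) e)) τ)); let nocc : (j : ℕ) → Fin 2 → (Fin 2 → ℝ) → ℝ := fun j σ p => (∑ x : TorusSite 2 (M j + 1), ∑ y : TorusSite 2 (M j + 1), torusChar (fun i => ((⌊p i * ((M j + 1 : ℕ) : ℝ) / (2 * Real.pi)⌋ : ℤ) : ZMod (M j + 1))) x * (starRingEnd ℂ) (torusChar (fun i => ((⌊p i * ((M j + 1 : ℕ) : ℝ) / (2 * Real.pi)⌋ : ℤ) : ZMod (M j + 1))) y) * expect (creation (orb (FermionTorus.ofTorusSite x) σ) * annihilation (orb (FermionTorus.ofTorusSite y) σ)) (ψ j)).re / ((M j + 1 : ℕ) : ℝ) ^ 2; (∃ c : ℝ, 0 < c ∧ ∃ᶠ j in atTop, c * ((M j + 1 : ℕ) : ℝ) ^ 2 ≤ (twoParticleRDM (ψ j)).supRayleigh) ∨ (∃ (R : Finset (Site 2)) (a : Site 2 → Fin 2 → Fin 2 → ℂ) (c : ℝ), 0 < c ∧ ∃ᶠ j in atTop, ∃ q : TorusSite 2 (M j + 1), q ≠ 0 ∧ c * ((M j + 1 : ℕ) : ℝ) ^ 4 ≤ (expect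 ((dens j R a q)ᴴ * dens j R a q) (ψ j)).re) ∨ (∃ (σ : Fin 2) (Z : ℝ) (γ : ℝ → (Fin 2 → ℝ)), 0 < Z ∧ Continuous γ ∧ γ 0 ≠ γ 1 ∧ ∀ t ∈ Set.Icc (0 : ℝ) 1, ∀ ε > (0 : ℝ), ∃ p p' : Fin 2 → ℝ, dist p (γ t) < ε ∧ dist p' (γ t) < ε ∧ ∀ᶠ j in atTop, nocc j σ p' + Z ≤ nocc j σ p)

/-- item stmt-HubbardSuperconductivity-1459 · support · rank 9 · closed · proved by Summit.HubbardSuperconductivity.HubbardSuperconductivity.Theorems.AnomalyExhaustion.evenSubsequenceReduction_proof @ 43b30c00bb23 (prover) · by planner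
sources: Scalapino1995, Literature.MathematicalPhysics.QuantumLattice.expect_pairField_conjTranspose_mul, Literature.Probability.LatticeModels.HasLongRangeOrder
[support] LIMINF BOOKKEEPING FOR THE ASSEMBLY (provable now, soft analysis). For any family ψ_L of
torus states normalised at even sides, if the summit's conclusion fails — ¬HasLongRangeOrder (k ↦
halfOpenBox 2 (2k)) (k ↦ torusPullback (pairFieldCorr dWaveFormFactor ψ) (2k)), i.e. liminf_k (2k)⁻⁴
Σ_{x,y∈Λ_{2k}} Re⟨P_x†P_y⟩ ≤ 0 — then there is a strictly increasing M with all M j+1 even such that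
(M j+1)⁻⁴ Re⟨ψ_{M j+1}, Δ_d†Δ_d ψ_{M j+1}⟩ → 0. Steps: the box sum of the pull-back equals the torus
double sum (torusProj_bijOn_halfOpenBox), which equals Re⟨Δ_d†Δ_d⟩ ≥ 0
(expect_pairField_conjTranspose_mul_holds, pairField_conjTranspose_mul_self_posSemidef); the
sequence is bounded (‖Δ_d‖ ≤ C·L² from ‖c‖ ≤ 1 and normalisation), so liminf ≤ 0 of a non-negative
bounded sequence yields a subsequence k_j ≥ 1 tending to 0; put M j := 2k_j - 1. Sources:
Literature.MathematicalPhysics.QuantumLattice.hasPairFieldLRO_iff_liminf_holds,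
expect_pairField_conjTranspose_mul_holds, Literature.Probability.LatticeModels.HasLongRangeOrder. -/
@[route_item "route-HubbardSuperconductivity-AnomalyExhaustion"]
def EvenSubsequenceReduction : Prop :=
  open Literature.MathematicalPhysics.QuantumLattice Literature.Probability.LatticeModels in ∀ (ψ : ∀ L, Fock (Orb (FermionTorus 2 L))), (∀ L, Even L → star (ψ L) ⬝ᵥ ψ L = 1) → ¬ HasLongRangeOrder (fun k => halfOpenBox 2 (2 * k)) (fun k => torusPullback (pairFieldCorr dWaveFormFactor ψ) (2 * k)) → ∃ M : ℕ → ℕ, StrictMono M ∧ (∀ j, Even (M j + 1)) ∧ Tendsto (fun j => (expect ((pairField dWaveFormFactor (M j + 1))ᴴ * pairField dWaveFormFactor (M j + 1)) (ψ (M j + 1))).re / ((M j + 1 : ℕ) : ℝ) ^ 4) atTop (𝓝 0)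

/-- item stmt-HubbardSuperconductivity-1460 · assembly · rank 1 · closed · proved by Summit.HubbardSuperconductivity.HubbardSuperconductivity.Theorems.AnomalyExhaustion.anomalyExhaustion_assembly_proof @ 43b30c00bb23 (prover) · by planner
sources: Scalapino1995, YangODLRO1962
[assembly] EtsTrichotomy → NoFermiArc → NoDensityWave → CondensateIsDWave → HubbardSuperconductivity
(soft analysis, provable now). Take δ := √2/5 ∈ (0,7/20) (irrational: irrational_sqrt_two), U₀ :=
min of the three thresholds at δ, U := U₀/2, c := c(U,δ) from CondensateIsDWave. Given N, ψ with the
summit hypothesis at even L, suppose the conclusion HasLongRangeOrder … fails;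
EvenSubsequenceReduction gives a strictly increasing M (even sides M j+1) with d_j := (M
j+1)⁻⁴Re⟨Δ_d†Δ_d⟩_{ψ(M j+1)} → 0; the family j ↦ ψ (M j+1) satisfies the common hypothesis block (N
(M j+1) = 2⌊(1-δ)(M j+1)²/2⌋ from the summit hypothesis). CondensateIsDWave: ∀η, eventually
c·λ_max/L² ≤ d_j + η, hence λ_max(ρ₂(ψ_j))/L_j² → 0, so (A) fails (a 'frequently ≥ c'L²' would give
c' ≤ 2(d_j+η)/c eventually); NoDensityWave with c/2 contradicts (B)'s 'frequently ≥ cL⁴'; NoFermiArc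
is ¬(C). EtsTrichotomy (U>0, δ irrational in (0,1/2)) asserts (A)∨(B)∨(C): contradiction. Hence
every sector-GS sequence has even-side d-wave pair-field LRO, i.e.
Literature.Hubbard.DWaveSuperconductivityHubbard with witnesses (U, δ) — HubbardSuperconductivity by
HubbardSuperconductivity_iff. Sources: Scalapino1995 §2, YangODLRO1962 §4. -/
@[route_item "route-HubbardSuperconductivity-AnomalyExhaustion"]
def Assembly : Prop :=
  EtsTrichotomy → NoFermiArc → NoDensityWave → CondensateIsDWave → HubbardSuperconductivity

end Summit.HubbardSuperconductivity.HubbardSuperconductivity.Theses.AnomalyExhaustion
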